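import Summits.AnomalousDissipation.AnomalousDissipation.Theorems.LaminarNeverLoud.Negative.StokesArc

/-!
# Negative knowledge for the crux `LaminarNeverLoud` (stmt-AnomalousDissipation-2988): III, load-bearing hypotheses and refuted strengthenings

Certified copy of §3b of the cdisprove work file `Cruxes/LaminarNeverLoud/Disproof.lean`.  Supports
stmt-AnomalousDissipation-2988.  LOAD-BEARING HYPOTHESES of the crux, all witnessed on the laminar Stokes arc of
`2a cos(2π m x₁)e₀`: without the energy bound the statement is false (`lnl_false_without_energyBound`; equivalently
`ν₀` cannot be uniform in `E`); without the smallness of `ν` it is false (`lnl_false_without_smallViscosity`: bounded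
laminar states at `ν = 1/π²` are loud); the strengthening with `ν₀` uniform over forces of `L²` mass `≤ 2` is false
(`not_lnl_uniform_in_force`: move the force to mode `m`, `ν_m = 1/(π²m²)`); and TIGHTNESS (`stokesArc_constraint`,
`nu0_le_of_admissible`): an admissible `ν₀` obeys `ν₀ ≤ a/(2√2π²√E)` once `ε ≤ a√(2E)`.  New definitions are the sets
`admissibleNoEnergySet`, `quietBoundedSet` (no named facts).
-/

noncomputable section

namespace Summit.AnomalousDissipation.AnomalousDissipation.Theorems.LaminarNeverLoud.Negative

open MeasureTheory Set Filter Topology UnitAddTorus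
open scoped InnerProductSpace
open Literature.Analysis.FluidPDE Literature.Analysis.FluidPDE.Torus
open Literature.Analysis.FunctionSpaces Literature.Analysis.FunctionSpaces.Torus
-- (migrate 2026-08-19) former `open …Theses.MirrorVariety (LaminarNeverLoud)` removed: the crux (item 2988, dropped at
-- rev 14) is the verbatim `@[conjecture] def Negative.LaminarNeverLoud` of `PowerBudget.lean`; no statement changed.

variable {d : Type*} [Fintype d] [DecidableEq d]

/-! ## §3b Load-bearing hypotheses and refuted strengthenings (all witnessed on the Stokes arc) -/

section LoadBearing

/-- Admissible thresholds WITHOUT THE ENERGY BOUND `∑‖c k‖² ≤ E` (equivalently: `ν₀` uniform in `E`). [folklore] -/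
def admissibleNoEnergySet (f : UnitAddTorus (Fin 3) → EuclideanSpace ℝ (Fin 3)) (ε : ℝ) : Set ℝ :=
  {ν₀ | ∀ N : ℕ, ∀ z ∈ steadySet (modes (Fin 3) N) (forceCoeff (modes (Fin 3) N) f),
    z ∈ laminarSet (steadySet (modes (Fin 3) N) (forceCoeff (modes (Fin 3) N) f)) →
      0 < z.2 → z.2 < ν₀ → dissipation z.2 z.1 < ε}

/-- The `ε` for which ALL BOUNDED LAMINAR STATES ARE `ε`-QUIET (the crux's matrix WITHOUT THE SMALLNESS `ν < ν₀`). [folklore] -/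
def quietBoundedSet (f : UnitAddTorus (Fin 3) → EuclideanSpace ℝ (Fin 3)) (E : ℝ) : Set ℝ :=
  {ε | ∀ N : ℕ, ∀ z ∈ steadySet (modes (Fin 3) N) (forceCoeff (modes (Fin 3) N) f),
    z ∈ laminarSet (steadySet (modes (Fin 3) N) (forceCoeff (modes (Fin 3) N) f)) →
      0 < z.2 → energy z.1 ≤ E → dissipation z.2 z.1 < ε}

/-- The gravest shear mode `(0,1,0)` is resolved at every `N ≥ 1`. [folklore] -/
theorem kol_one_mem {N : ℕ} (hN : 1 ≤ N) : kol 1 ∈ modes (Fin 3) N := kol_mem_modes one_ne_zero hN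

/-- `-(0,1,0)` is resolved at every `N ≥ 1`. [folklore] -/
theorem neg_kol_one_mem {N : ℕ} (hN : 1 ≤ N) : -kol 1 ∈ modes (Fin 3) N := neg_kol_mem_modes one_ne_zero hN

/-- The Stokes point of the shear force, as a laminar point of the crux's variety `V_N(f)`. [folklore] -/
theorem stokesPoint_laminar_mem {m : ℤ} (hm : m ≠ 0) {N : ℕ} (hN : m.natAbs ≤ N) (a : ℝ) {ν : ℝ}
    (hν : 0 < ν) :
    stokesPoint (modes (Fin 3) N) m a ν ∈
        steadySet (modes (Fin 3) N) (forceCoeff (modes (Fin 3) N) (shearForce m a)) ∧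
      stokesPoint (modes (Fin 3) N) m a ν ∈
        laminarSet (steadySet (modes (Fin 3) N) (forceCoeff (modes (Fin 3) N) (shearForce m a))) := by
  rw [forceCoeff_shearForce]
  exact ⟨stokesPoint_mem (kol_mem_modes hm hN) (neg_kol_mem_modes hm hN) hm a hν.ne',
    isLaminar_stokesPoint (kol_mem_modes hm hN) (neg_kol_mem_modes hm hN) hm a hν⟩

/-- **THE ENERGY BOUND CARRIES LOAD**: without `∑‖c k‖² ≤ E` the statement is false — the Stokes arc of
`2cos(2πx₁)e₀` at `N = 1` has dissipation `1/(2π²ν) → ∞`.  Equivalently `ν₀` cannot be uniform in `E`: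
any proof must use the energy ceiling quantitatively. [folklore] -/
theorem lnl_false_without_energyBound :
    ¬ ∀ f : UnitAddTorus (Fin 3) → EuclideanSpace ℝ (Fin 3), IsSmooth f → IsDivFree f → HasZeroMean f →
      ∀ ε : ℝ, 0 < ε → ∃ ν₀ ∈ admissibleNoEnergySet f ε, 0 < ν₀ := by
  intro h
  obtain ⟨ν₀, H, hν₀⟩ := h (shearForce 1 1) (isSmooth_shearForce 1 1) (isDivFree_shearForce 1 1)
    (hasZeroMean_shearForce one_ne_zero 1) 1 one_pos
  set ν : ℝ := min (ν₀ / 2) (1 / (2 * Real.pi ^ 2)) with hν_def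
  have hνpos : 0 < ν := lt_min (by linarith) (by positivity)
  have hνlt : ν < ν₀ := (min_le_left _ _).trans_lt (by linarith)
  have hνle : ν ≤ 1 / (2 * Real.pi ^ 2) := min_le_right _ _
  obtain ⟨hmem, hlam⟩ := stokesPoint_laminar_mem (m := 1) one_ne_zero (N := 1) le_rfl 1 hνpos
  have hlt := H 1 _ hmem hlam hνpos hνlt
  rw [stokesPoint_snd,
    dissipation_stokesPoint_eq (kol_one_mem le_rfl) (neg_kol_one_mem le_rfl) one_ne_zero 1 hνpos.ne']
    at hlt
  -- `1/(2π²ν) ≥ 1` since `ν ≤ 1/(2π²)`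
  have hge : (1 : ℝ) ≤ 1 ^ 2 / (2 * Real.pi ^ 2 * ν * ((1 : ℤ) : ℝ) ^ 2) := by
    rw [Int.cast_one, one_pow, mul_one, le_div_iff₀ (by positivity), one_mul]
    calc 2 * Real.pi ^ 2 * ν ≤ 2 * Real.pi ^ 2 * (1 / (2 * Real.pi ^ 2)) :=
          mul_le_mul_of_nonneg_left hνle (by positivity)
      _ = 1 := by field_simp
  linarith

/-- **THE SMALLNESS OF `ν` CARRIES LOAD**: bounded laminar states at moderate viscosity ARE loud — the
Stokes point of `2cos(2πx₁)e₀` at `ν = 1/π²`, `N = 1` has energy `1/8` and dissipation `1/2`.  So the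
crux is genuinely an asymptotic (`ν → 0`) statement; `ν₀` must be allowed to depend on `(f, E, ε)`. [folklore] -/
theorem lnl_false_without_smallViscosity :
    ¬ ∀ f : UnitAddTorus (Fin 3) → EuclideanSpace ℝ (Fin 3), IsSmooth f → IsDivFree f → HasZeroMean f →
      ∀ E ε : ℝ, 0 < ε → ε ∈ quietBoundedSet f E := by
  intro h
  have hν : (0 : ℝ) < 1 / Real.pi ^ 2 := by positivity
  obtain ⟨hmem, hlam⟩ := stokesPoint_laminar_mem (m := 1) one_ne_zero (N := 1) le_rfl 1 hν
  have hlt := h (shearForce 1 1) (isSmooth_shearForce 1 1) (isDivFree_shearForce 1 1)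
    (hasZeroMean_shearForce one_ne_zero 1) (1 / 8) (1 / 2) (by norm_num) 1 _ hmem hlam hν ?_
  · rw [stokesPoint_snd,
      dissipation_stokesPoint_eq (kol_one_mem le_rfl) (neg_kol_one_mem le_rfl) one_ne_zero 1 hν.ne']
      at hlt
    have : (1 : ℝ) ^ 2 / (2 * Real.pi ^ 2 * (1 / Real.pi ^ 2) * ((1 : ℤ) : ℝ) ^ 2) = 1 / 2 := by
      rw [Int.cast_one]; field_simp
    linarith
  · rw [energy_stokesPoint (kol_one_mem le_rfl) (neg_kol_one_mem le_rfl) one_ne_zero]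
    have : (2 : ℝ) * (1 / (4 * Real.pi ^ 2 * (1 / Real.pi ^ 2) * ((1 : ℤ) : ℝ) ^ 2)) ^ 2 = 1 / 8 := by
      rw [Int.cast_one]; field_simp; norm_num
    rw [this]

/-- **NO UNIFORMITY IN THE FORCE, EVEN AT FIXED `L²` MASS**: the strengthening with `ν₀` depending on `f`
only through `∫‖f‖² ≤ 2` is false.  Witness: `f_m = 2cos(2π m x₁)e₀` (`∫‖f_m‖² = 2` for all `m`), `E = 1/8`,
`ε = 1/2`; the Stokes point at resolution `N = m` and viscosity `ν_m = 1/(π²m²) → 0` has energy EXACTLY `1/8`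
and dissipation EXACTLY `1/2` for every `m`.  Reading: `ν₀` must see the SCALE of the force (here
`ν₀ ≲ ‖Δ⁻¹f‖₂/√E`), not a rearrangement-invariant size; the Stokes arc is loud-and-bounded exactly in the
window `a/(2√2π²m²√E) ≤ ν ≤ a²/(2π²m²ε)`. [folklore] -/
theorem not_lnl_uniform_in_force :
    ¬ ∀ E ε : ℝ, 0 < ε → ∃ ν₀ : ℝ, 0 < ν₀ ∧
      ∀ f : UnitAddTorus (Fin 3) → EuclideanSpace ℝ (Fin 3), IsSmooth f → IsDivFree f → HasZeroMean f →
        ∫ x, ‖f x‖ ^ 2 ≤ 2 → ν₀ ∈ admissibleSet f E ε := by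
  intro h
  obtain ⟨ν₀, hν₀, H⟩ := h (1 / 8) (1 / 2) (by norm_num)
  -- a mode `m ≥ 1` with `1/(π² m²) < ν₀`
  obtain ⟨m, hm⟩ := exists_nat_gt (1 / (Real.pi ^ 2 * ν₀))
  have hm1 : 1 ≤ m := by
    rcases Nat.eq_zero_or_pos m with rfl | hpos
    · exfalso
      have : (0 : ℝ) < 1 / (Real.pi ^ 2 * ν₀) := by positivity
      rw [Nat.cast_zero] at hm
      linarith
    · exact hpos
  have hmR : (1 : ℝ) ≤ m := by exact_mod_cast hm1
  have hmpos : (0 : ℝ) < m := by linarith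
  set ν : ℝ := 1 / (Real.pi ^ 2 * (m : ℝ) ^ 2) with hν_def
  have hνpos : 0 < ν := by positivity
  have hνlt : ν < ν₀ := by
    rw [hν_def, div_lt_iff₀ (by positivity)]
    rw [div_lt_iff₀ (by positivity)] at hm
    nlinarith [Real.pi_pos, mul_pos (mul_pos Real.pi_pos Real.pi_pos) hν₀]
  have hmZ : ((m : ℤ)) ≠ 0 := by exact_mod_cast (by omega : m ≠ 0)
  have hnat : ((m : ℤ)).natAbs ≤ m := by simp
  obtain ⟨hmem, hlam⟩ := stokesPoint_laminar_mem hmZ hnat 1 hνpos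
  have hp : kol (m : ℤ) ∈ modes (Fin 3) m := kol_mem_modes hmZ hnat
  have hn : -kol (m : ℤ) ∈ modes (Fin 3) m := neg_kol_mem_modes hmZ hnat
  have hmass : ∫ x, ‖shearForce (m : ℤ) 1 x‖ ^ 2 ≤ 2 := by
    rw [shearForce, integral_norm_sq_realTrigPoly (shearModes_symm _) (isConjSymm_shearCoeff _ 1),
      shearModes, Finset.sum_pair (kol_ne_neg hmZ), shearCoeff_of_shear 1 (Or.inl rfl),
      shearCoeff_of_shear 1 (Or.inr rfl), norm_smul_e0_sq]
    norm_num
  have hlt := H (shearForce (m : ℤ) 1) (isSmooth_shearForce _ 1) (isDivFree_shearForce _ 1)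
    (hasZeroMean_shearForce hmZ 1) hmass m _ hmem hlam hνpos hνlt ?_
  · rw [stokesPoint_snd, dissipation_stokesPoint_eq hp hn hmZ 1 hνpos.ne'] at hlt
    have : (1 : ℝ) ^ 2 / (2 * Real.pi ^ 2 * ν * (((m : ℤ)) : ℝ) ^ 2) = 1 / 2 := by
      rw [Int.cast_natCast, hν_def]; field_simp
    linarith
  · rw [energy_stokesPoint hp hn hmZ]
    have : (2 : ℝ) * (1 / (4 * Real.pi ^ 2 * ν * (((m : ℤ)) : ℝ) ^ 2)) ^ 2 = 1 / 8 := by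
      rw [Int.cast_natCast, hν_def]; field_simp; norm_num
    rw [this]

/-- **TIGHTNESS ON THE STOKES ARC** (how small `ν₀` must be): if `ν₀` is admissible for the shear force
`2a cos(2πx₁)e₀` with budgets `(E, ε)` (the crux's conclusion, used at `N = 1` only), then every
`ν ∈ (0, ν₀)` whose Stokes point is bounded, `2(a/(4π²ν))² ≤ E`, has `a²/(2π²ν) < ε`.  Contrapositively:
whenever `ε ≤ a√(2E)`, `ν₀ ≤ a/(2√2 π² √E)` — the laminar threshold scales like `‖Δ⁻¹f‖₂ E^{-1/2}`. [folklore] -/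
theorem stokesArc_constraint {a E ε ν₀ : ℝ} (hadm : ν₀ ∈ admissibleSet (shearForce 1 a) E ε)
    {ν : ℝ} (hν : 0 < ν) (hνlt : ν < ν₀) (hE : 2 * (a / (4 * Real.pi ^ 2 * ν)) ^ 2 ≤ E) :
    a ^ 2 / (2 * Real.pi ^ 2 * ν) < ε := by
  obtain ⟨hmem, hlam⟩ := stokesPoint_laminar_mem (m := 1) one_ne_zero (N := 1) le_rfl a hν
  have hlt := hadm 1 _ hmem hlam hν hνlt ?_
  · rw [stokesPoint_snd,
      dissipation_stokesPoint_eq (kol_one_mem le_rfl) (neg_kol_one_mem le_rfl) one_ne_zero a hν.ne',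
      Int.cast_one, one_pow, mul_one] at hlt
    exact hlt
  · rw [energy_stokesPoint (kol_one_mem le_rfl) (neg_kol_one_mem le_rfl) one_ne_zero, Int.cast_one,
      one_pow, mul_one]
    exact hE

/-- The normalised instance: for `f = 2cos(2πx₁)e₀`, `E = 1/8`, `ε = 1/2`, every admissible `ν₀` satisfies
`ν₀ ≤ 1/π²` (the Stokes point at `ν = 1/π²` has energy `1/8`, dissipation `1/2`). [folklore] -/
theorem nu0_le_of_admissible {ν₀ : ℝ} (hadm : ν₀ ∈ admissibleSet (shearForce 1 1) (1 / 8) (1 / 2)) :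
    ν₀ ≤ 1 / Real.pi ^ 2 := by
  refine le_of_not_gt fun hlt => ?_
  have hν : (0 : ℝ) < 1 / Real.pi ^ 2 := by positivity
  have h := stokesArc_constraint hadm hν hlt (le_of_eq (by field_simp; norm_num))
  have : (1 : ℝ) ^ 2 / (2 * Real.pi ^ 2 * (1 / Real.pi ^ 2)) = 1 / 2 := by field_simp
  linarith

end LoadBearing

end Summit.AnomalousDissipation.AnomalousDissipation.Theorems.LaminarNeverLoud.Negative
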